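import Summits.AnomalousDissipation.AnomalousDissipation.Theorems.SolenoidalFractalHomogenisationLagrangianStepD1SplitR
import Summits.AnomalousDissipation.AnomalousDissipation.Theorems.SolenoidalFractalHomogenisationLagrangianStepVmodDistortedDefs
import HarnessLib

/-!
# K1L_D (stmt-AnomalousDissipation-27980): the D1 SPLIT GLUE, GRADED-(V_θ) TWIN (RULINGS D28-1 (5), D28-3 (3), D28-4; prover lead-k1l-onelevel-p1 g6)
(helper, `--supports 27980 --as helper`; θg-twin of `…D1SplitR` (prover ad-sawtooth-k1loc-p1 g14, p-landed) — bookkeeping over the design stub `stub_D1_V0θg`.)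

From registry v28 the design delivers, next to the window family, the constants block
`∃ θV > 0, ∃ σ > 0, ∃ C, 0 ≤ C ∧ ∃ ν₀ > 0, ∃ K > 0, VmodDist.SlowVectorClauseFθg cubatureWord M hM c Φ lo hi ΛV β σ C ν₀ K θV`
(the GRADED (V_θ) clause of record, amendment 2 of `…VmodDistortedDefs`; its `θ = 0` member is (V) without existence by
`VmodDist.noExF_of_clauseFθ le_rfl ∘ VmodDist.clauseFθ_zero_of_clauseFθg`).  This file is `…D1SplitR` with that block in place of
`∃ σ > 0, ∃ C, 0 ≤ C ∧ ∃ ν₀ > 0, ∃ K > 0, SlowVectorClauseNoExF cubatureWord M hM c Φ lo hi ΛV β σ C ν₀ K`: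
* `D1ExactFamilyRθg Φ₀ ρ M hM` — `D1ExactFamilyR` with the θg block in clause (ii);
* `D1ExactFamilyRθg_of_split` (witness `pieceFamily Ψ₁ Φ₀ ν₁`; uses `SlowVectorClauseFθg.congr_Ioo/.mono_ν₀`), `D1ExactFamilyRBθg_of_split`;
* `cellLawV0_IS_statement_of_WCrossingQ` — the packing lemma `cellLawV0_IS_statement_of_WCrossing` (…WCrossingWindow) made GENERIC in the trailing
  constants block `Q M hM c Φ lo hi ΛV β` (pure pass-through), and its θg instance inside `cellLawV0θg_IS_statement_of_D1R`;
* `cellLawV0θg_IS_of_W_D1R` — the v28 design glue: `(∃ a > 0, EvenSlackWindowB a ρB) → (∀ a > 0, D1ExactFamilyRθg (ΦB a) ρB MB MB_pos) → ScalarLawBlock … →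
  ⟨the `stub_cellLawV0_IS` package with the θg block⟩` (the shape `LagrangianRenormalisationStepDesign_of` destructures as
  `⟨M, hM, c, hc', Φ, …, hWF, θV, hθV, σ, hσ, C, hC, ν₀, hν₀, K, hK, hVθ'⟩`);
* `D1ExactFamilyRBθg_of_residue_of_V0θg` — registry one-liner: `stub_D1_residue` + `stub_D1_V0θg` (D28-3 (3) text) ⇒ `∀ a > 0, D1ExactFamilyRθg (ΦB a) ρB MB MB_pos`;
(Sanity rung «θg obligation ⇒ `D1ExactFamilyR`» = `VmodDist.noExF_of_clauseFθg` of …VmodThetaRungG applied inside clause (ii); not restated here.)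
`sorry`-free; NOT a proof of `stub_D1_V0θg`, K1L_D or AD; rung F-D1.A0.
-/

set_option linter.dupNamespace false

namespace Summit.AnomalousDissipation.AnomalousDissipation.Theorems.SolenoidalFractalHomogenisation.LagrangianStep.WCrossing

open Summit.AnomalousDissipation.AnomalousDissipation.Theorems
open Summit.AnomalousDissipation.AnomalousDissipation.Theorems.SolenoidalFractalHomogenisation.LagrangianStep
open Literature.Analysis Literature.Analysis.FluidPDE Literature.Analysis.FunctionSpaces
open Set

noncomputable section

/-- **OBLIGATION D1, window-honest form, GRADED-(V_θ) constants block (v28).**  `D1ExactFamilyR Φ₀ ρ M hM` with clause (ii)'s block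
`∃ σ > 0, ∃ C, 0 ≤ C ∧ ∃ ν₀ > 0, ∃ K > 0, SlowVectorClauseNoExF …` replaced by `∃ θV > 0, ∃ σ > 0, ∃ C, 0 ≤ C ∧ ∃ ν₀ > 0, ∃ K > 0, VmodDist.SlowVectorClauseFθg … θV`. -/
def D1ExactFamilyRθg (Φ₀ : T4 → T4) (ρ M : ℝ) (hM : 0 < M) : Prop :=
  ∃ Ψ : ℝ → T4 → T4,
    (∀ ν : ℝ, ∀ S : T4, Torus.NearIso S (10 / 11) (11 / 10) → ∀ τ ∈ Set.Icc (0:ℝ) (1 / 20), OddSectorial S τ →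
        RelSmall (Ψ ν S - Φ₀ S) (Φ₀ S) ρ) ∧
    (∃ c > (0:ℝ), ∀ lo hi ΛV β : ℝ, 0 < lo → lo ≤ hi → 1 < ΛV → 0 ≤ β → hi * ΛV ≤ 11 / 10 → 10 / 11 * ΛV ≤ lo → β * ΛV ≤ lo / 20 →
        ∃ θV > (0:ℝ), ∃ σ > (0:ℝ), ∃ C : ℝ, 0 ≤ C ∧ ∃ ν₀ > (0:ℝ), ∃ K > (0:ℝ),
          VmodDist.SlowVectorClauseFθg cubatureWord M hM c Ψ lo hi ΛV β σ C ν₀ K θV)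

/-- **`D1ExactFamilyRθg` from the split** (copy of `D1ExactFamilyR_of_split` with the θg block): residue for `Ψ₁` on `ν ∈ (0, ν₁]`, transverse
nonnegativity of `Φ₀` on the block window, and the θg block for `Ψ₁` give `D1ExactFamilyRθg Φ₀ ρ M hM`, witnessed by `pieceFamily Ψ₁ Φ₀ ν₁`. -/
theorem D1ExactFamilyRθg_of_split {Φ₀ : T4 → T4} {Ψ₁ : ℝ → T4 → T4} {ρ M ν₁ : ℝ} (hM : 0 < M) (hρ : 0 ≤ ρ) (hν₁ : 0 < ν₁)
    (h0 : ∀ S : T4, Torus.NearIso S (10 / 11) (11 / 10) → ∀ τ ∈ Set.Icc (0:ℝ) (1 / 20), OddSectorial S τ → TransNonneg (Φ₀ S))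
    (hres : ∀ ν ∈ Set.Ioc 0 ν₁, ∀ S : T4, Torus.NearIso S (10 / 11) (11 / 10) → ∀ τ ∈ Set.Icc (0:ℝ) (1 / 20), OddSectorial S τ →
      RelSmall (Ψ₁ ν S - Φ₀ S) (Φ₀ S) ρ)
    (hV0 : ∃ c > (0:ℝ), ∀ lo hi ΛV β : ℝ, 0 < lo → lo ≤ hi → 1 < ΛV → 0 ≤ β → hi * ΛV ≤ 11 / 10 → 10 / 11 * ΛV ≤ lo → β * ΛV ≤ lo / 20 →
      ∃ θV > (0:ℝ), ∃ σ > (0:ℝ), ∃ C : ℝ, 0 ≤ C ∧ ∃ ν₀ > (0:ℝ), ∃ K > (0:ℝ),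
        VmodDist.SlowVectorClauseFθg cubatureWord M hM c Ψ₁ lo hi ΛV β σ C ν₀ K θV) :
    D1ExactFamilyRθg Φ₀ ρ M hM := by
  refine ⟨pieceFamily Ψ₁ Φ₀ ν₁, ?_, ?_⟩
  · intro ν S hS τ hτ hodd
    by_cases hν : 0 < ν ∧ ν ≤ ν₁
    · rw [pieceFamily_of_mem hν]
      exact hres ν ⟨hν.1, hν.2⟩ S hS τ hτ hodd
    · rw [pieceFamily_of_not_mem hν, sub_self]
      exact RelSmall.zero (h0 S hS τ hτ hodd) hρ
  · obtain ⟨c, hc, hV⟩ := hV0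
    refine ⟨c, hc, fun lo hi ΛV β hlo hlh hΛV hβ h1 h2 h3 => ?_⟩
    obtain ⟨θV, hθV, σ, hσ, C, hC, ν₀, hν₀, K, hK, hcl⟩ := hV lo hi ΛV β hlo hlh hΛV hβ h1 h2 h3
    refine ⟨θV, hθV, σ, hσ, C, hC, min ν₀ ν₁, lt_min hν₀ hν₁, K, hK, ?_⟩
    refine VmodDist.SlowVectorClauseFθg.congr_Ioo (fun ν hν => ?_) (VmodDist.SlowVectorClauseFθg.mono_ν₀ (min_le_left ν₀ ν₁) hcl)
    exact (pieceFamily_of_mem ⟨hν.1, hν.2.le.trans (min_le_right _ _)⟩).symm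

/-- **The branch-B obligation with the θg block, from the split** (copy of `D1ExactFamilyRB_of_split`): for every normalisation `a > 0`, the residue
for `Ψ₁ a` on `(0, ν₁]` (the registered `stub_D1_residue` text at `Ψ₁ := ΨB₁`, `ν₁ := νB₁`) and the θg block for `Ψ₁ a` (the conclusion of
`stub_D1_V0θg`) give `D1ExactFamilyRθg (ΦB a) ρB MB MB_pos`. -/
theorem D1ExactFamilyRBθg_of_split {Ψ₁ : ℝ → ℝ → T4 → T4} {ν₁ : ℝ} (hν₁ : 0 < ν₁)
    (hres : ∀ a > (0:ℝ), ∀ ν ∈ Set.Ioc 0 ν₁, ∀ S : T4, Torus.NearIso S (10 / 11) (11 / 10) →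
      ∀ τ ∈ Set.Icc (0:ℝ) (1 / 20), OddSectorial S τ → RelSmall (Ψ₁ a ν S - ΦB a S) (ΦB a S) ρB)
    (hV0 : ∀ a > (0:ℝ), ∃ c > (0:ℝ), ∀ lo hi ΛV β : ℝ, 0 < lo → lo ≤ hi → 1 < ΛV → 0 ≤ β → hi * ΛV ≤ 11 / 10 → 10 / 11 * ΛV ≤ lo →
      β * ΛV ≤ lo / 20 →
      ∃ θV > (0:ℝ), ∃ σ > (0:ℝ), ∃ C : ℝ, 0 ≤ C ∧ ∃ ν₀ > (0:ℝ), ∃ K > (0:ℝ),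
        VmodDist.SlowVectorClauseFθg cubatureWord MB MB_pos c (Ψ₁ a) lo hi ΛV β σ C ν₀ K θV) :
    ∀ a > (0:ℝ), D1ExactFamilyRθg (ΦB a) ρB MB MB_pos := by
  intro a ha
  exact D1ExactFamilyRθg_of_split MB_pos ρB_nonneg hν₁ (fun S hS τ hτ hodd => transNonneg_ΦB ha.le hS hτ hodd) (hres a ha) (hV0 a ha)

/-- **Packing into the registered stub's ∃-statement, GENERIC in the trailing constants block** (copy of `cellLawV0_IS_statement_of_WCrossing`,
…WCrossingWindow, with `∃ σ > 0, …, SlowVectorClauseNoExF cubatureWord M hM c Φ lo hi ΛV β σ C ν₀ K` replaced by an arbitrary `Q M hM c Φ lo hi ΛV β`;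
pure pass-through, defect family `μ ≡ 1`). [folklore] -/
theorem cellLawV0_IS_statement_of_WCrossingQ (Q : (M : ℝ) → 0 < M → ℝ → (ℝ → T4 → T4) → ℝ → ℝ → ℝ → ℝ → Prop)
    {M : ℝ} (hM : 0 < M) {c : ℝ} (hc : 0 < c)
    {Φ : ℝ → T4 → T4} {Φ₀ : T4 → T4} {Sstar : T4} {slo shi lam₀ Λ Λc ΛV τ₀ τlo κ ε ρ δ : ℝ}
    (hstarI : Torus.NearIso Sstar slo shi) (hslo : 0 < slo) (hslo1 : slo ≤ 1) (hshi1 : 1 ≤ shi) (hlam₀ : 1 ≤ lam₀)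
    (hiso : InInterval Sstar lam₀ (Torus.isoVisc 1))
    (hO : SectorialOddChannelBoundOn Φ₀ Sstar lam₀ Λ κ ε τ₀) (hE : EvenSlackOnInterval Φ₀ Sstar lam₀ Λ τ₀ δ)
    (hR : ∀ ν, ResidueOnInterval (Φ ν) Φ₀ Sstar lam₀ Λ τ₀ ρ)
    (hκ : 0 ≤ κ) (hε : 0 ≤ ε) (hρ : 0 ≤ ρ) (hδ : 0 ≤ δ) (hfit : 1 ≤ (1 - ρ) * (1 + δ)) (hgain : κ + ρ < 1)
    (hτlo : (ε + 2 * ρ) / (1 - ρ - κ) ≤ τlo)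
    (hΛc : lam₀ ≤ Λc) (hΛV : 1 < ΛV) (hfitV : ΛV * Λc * shi ≤ Λ * slo)
    (hτ₀ : τlo * ΛV * (shi * Λc) / (slo / Λc) ≤ τ₀)
    (hV : Q M hM c Φ (slo / Λc) (shi * Λc) ΛV (τlo * (shi * Λc))) :
    ∃ M : ℝ, ∃ hM : 0 < M, ∃ c > (0:ℝ), ∃ Φ : ℝ → Torus.Visc4 (Fin 3) → Torus.Visc4 (Fin 3), ∃ μ : ℝ → ℝ, ∃ Sstar : Torus.Visc4 (Fin 3),
      ∃ slo shi lam₀ Λ Λc Λ' τlo τhi τc : ℝ, ∃ lo > (0:ℝ), ∃ hi : ℝ, lo ≤ 1 ∧ 1 ≤ hi ∧ ∃ ΛV > (1:ℝ), ∃ β ≥ (0:ℝ),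
        SectorialIntervalWindowFamily Φ μ Sstar slo shi lam₀ Λ Λc Λ' τlo τhi τc β lo hi ΛV ∧ Q M hM c Φ lo hi ΛV β := by
  have hsh : slo ≤ shi := hslo1.trans hshi1
  have hΛc1 : 1 ≤ Λc := hlam₀.trans hΛc
  have hΛc0 : 0 < Λc := by linarith
  have hτlo0 : 0 ≤ τlo := le_trans (div_nonneg (by linarith) (by linarith)) hτlo
  have hlo1 : slo / Λc ≤ 1 := (div_le_self hslo.le hΛc1).trans hslo1
  have hhi1 : 1 ≤ shi * Λc := one_le_mul_of_one_le_of_one_le hshi1 hΛc1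
  have hβ : 0 ≤ τlo * (shi * Λc) := mul_nonneg hτlo0 (by positivity)
  exact ⟨M, hM, c, hc, Φ, fun _ => 1, Sstar, slo, shi, lam₀, Λ, Λc, Λ, τlo, τlo * ΛV * (shi * Λc) / (slo / Λc), τlo, slo / Λc,
    div_pos hslo hΛc0, shi * Λc, hlo1, hhi1, ΛV, hΛV, τlo * (shi * Λc), hβ,
    windowFamily_of_WCrossing hstarI hslo hsh hlam₀ hiso hO hE hR hκ hε hρ hδ hfit hgain hτlo hΛc hΛV hfitV hτ₀, hV⟩

/-- **The `stub_cellLawV0_IS` package with the θg block, from the two obligations** (copy of `cellLawV0_IS_statement_of_D1R`; the guard at the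
consumer's instance is `consumer_guard`). [folklore] -/
theorem cellLawV0θg_IS_statement_of_D1R {Φ₀ : T4 → T4} {ρ M : ℝ} (hM : 0 < M) (hρ0 : 0 ≤ ρ)
    (hW : ClosedFormWindowB Φ₀ ρ) (hD : D1ExactFamilyRθg Φ₀ ρ M hM) :
    ∃ M : ℝ, ∃ hM : 0 < M, ∃ c > (0:ℝ), ∃ Φ : ℝ → Torus.Visc4 (Fin 3) → Torus.Visc4 (Fin 3), ∃ μ : ℝ → ℝ, ∃ Sstar : Torus.Visc4 (Fin 3),
      ∃ slo shi lam₀ Λ Λc Λ' τlo τhi τc : ℝ, ∃ lo > (0:ℝ), ∃ hi : ℝ, lo ≤ 1 ∧ 1 ≤ hi ∧ ∃ ΛV > (1:ℝ), ∃ β ≥ (0:ℝ),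
        SectorialIntervalWindowFamily Φ μ Sstar slo shi lam₀ Λ Λc Λ' τlo τhi τc β lo hi ΛV ∧
        ∃ θV > (0:ℝ), ∃ σ > (0:ℝ), ∃ C : ℝ, 0 ≤ C ∧ ∃ ν₀ > (0:ℝ), ∃ K > (0:ℝ),
          VmodDist.SlowVectorClauseFθg cubatureWord M hM c Φ lo hi ΛV β σ C ν₀ K θV := by
  obtain ⟨Sstar, slo, shi, lam₀, Λ, Λc, ΛV, τ₀, κ, ε, δ, hstarI, hslo, hslo1, hshi1, hlam₀, hiso, hκ, hε, hδ, hfit, hgain, hΛc, hΛV,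
    hfitV, hwinhi, hwinlo, hVhi, hVlo, hτ₀, hτ₀', hO, hE⟩ := hW
  obtain ⟨Ψ, hres, c, hc, hVc⟩ := hD
  have hΛc1 : 1 ≤ Λc := hlam₀.trans hΛc
  have hΛc0 : 0 < Λc := by linarith
  set τlo : ℝ := (ε + 2 * ρ) / (1 - ρ - κ) with hτlo_def
  have hτlo0 : 0 ≤ τlo := div_nonneg (by linarith) (by linarith)
  -- the residue on the interval window
  have hR : ∀ ν, ResidueOnInterval (Ψ ν) Φ₀ Sstar lam₀ Λ τ₀ ρ := by
    intro ν lam hlam S τ hτ hSi hSo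
    have hlam1 : 1 ≤ lam := hlam₀.trans hlam.1
    have hlam0 : 0 < lam := by linarith
    have hN : Torus.NearIso S (10 / 11) (11 / 10) := by
      refine (InInterval.nearIso hlam1 hstarI hSi).mono ?_ ?_
      · rw [le_div_iff₀ hlam0]; nlinarith [hlam.2]
      · nlinarith [hlam.2, hslo.trans_le (hslo1.trans hshi1)]
    exact hres ν S hN τ ⟨hτ.1, hτ.2.trans hτ₀'⟩ hSo
  -- the θg block on the window (slo/Λc, shi·Λc, ΛV, τlo·shi·Λc); the guard holds by `consumer_guard`
  have hV := hVc (slo / Λc) (shi * Λc) ΛV (τlo * (shi * Λc)) (div_pos hslo hΛc0)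
    ((div_le_self hslo.le hΛc1).trans (hslo1.trans (hshi1.trans (le_mul_of_one_le_right (by linarith) hΛc1))))
    hΛV (mul_nonneg hτlo0 (by positivity)) hVhi hVlo (consumer_guard hslo hΛc1 hτ₀ hτ₀')
  exact cellLawV0_IS_statement_of_WCrossingQ
    (fun M hM c Φ lo hi ΛV β => ∃ θV > (0:ℝ), ∃ σ > (0:ℝ), ∃ C : ℝ, 0 ≤ C ∧ ∃ ν₀ > (0:ℝ), ∃ K > (0:ℝ),
      VmodDist.SlowVectorClauseFθg cubatureWord M hM c Φ lo hi ΛV β σ C ν₀ K θV)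
    hM hc hstarI hslo hslo1 hshi1 hlam₀ hiso hO hE hR hκ hε hρ0 hδ hfit hgain le_rfl hΛc hΛV hfitV hτ₀ hV

/-- **Registry-v28 design glue: the `stub_cellLawV0_IS` package with the θg block from the two by-name obligations** (copy of
`cellLawV0_IS_of_W_D1R`): the even-slack window at the branch-B point for some normalisation (`WEvenCert.stub_W_evenSlackB`) and the θg exact
family for every normalisation. -/
theorem cellLawV0θg_IS_of_W_D1R (hW : ∃ a > (0:ℝ), EvenSlackWindowB a ρB)
    (hD : ∀ a > (0:ℝ), D1ExactFamilyRθg (ΦB a) ρB MB MB_pos) :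
    ScalarLawBlock Summit.AnomalousDissipation.AnomalousDissipation.Theorems.cubatureWord Summit.AnomalousDissipation.AnomalousDissipation.Theorems.c0 →
    ∃ M : ℝ, ∃ hM : 0 < M, ∃ c > (0:ℝ), ∃ Φ : ℝ → Torus.Visc4 (Fin 3) → Torus.Visc4 (Fin 3), ∃ μ : ℝ → ℝ,
      ∃ Sstar : Torus.Visc4 (Fin 3), ∃ slo shi lam₀ Λ Λc Λ' τlo τhi τc : ℝ,
      ∃ lo > (0:ℝ), ∃ hi : ℝ, lo ≤ 1 ∧ 1 ≤ hi ∧ ∃ ΛV > (1:ℝ), ∃ β ≥ (0:ℝ),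
      SectorialIntervalWindowFamily Φ μ Sstar slo shi lam₀ Λ Λc Λ' τlo τhi τc β lo hi ΛV ∧
      ∃ θV > (0:ℝ), ∃ σ > (0:ℝ), ∃ C : ℝ, 0 ≤ C ∧ ∃ ν₀ > (0:ℝ), ∃ K > (0:ℝ),
        VmodDist.SlowVectorClauseFθg Summit.AnomalousDissipation.AnomalousDissipation.Theorems.cubatureWord M hM c Φ lo hi ΛV β σ C ν₀ K θV := by
  intro _
  obtain ⟨a, ha, h⟩ := hW
  exact cellLawV0θg_IS_statement_of_D1R MB_pos ρB_nonneg (closedFormWindowB_of_evenSlack h) (hD a ha)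

/-- **The registry's one-line use (the v28 shape):** the residue theorem (registered `stub_D1_residue` text) and the design stub `stub_D1_V0θg`
(«(i) ⇒ guarded θg block», RULING D28-3 (3) text) give the θg branch-B obligation for every normalisation. [folklore] -/
theorem D1ExactFamilyRBθg_of_residue_of_V0θg
    (hres : ∀ a > (0:ℝ), ∀ ν ∈ Set.Ioc 0 νB₁, ∀ S, Torus.NearIso S (10/11) (11/10) →
      ∀ τ ∈ Set.Icc (0:ℝ) (1/20), OddSectorial S τ → RelSmall (ΨB₁ a ν S - ΦB a S) (ΦB a S) ρB)
    (hV0θg : (∀ a > (0:ℝ), ∀ ν ∈ Set.Ioc 0 νB₁, ∀ S, Torus.NearIso S (10/11) (11/10) →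
      ∀ τ ∈ Set.Icc (0:ℝ) (1/20), OddSectorial S τ → RelSmall (ΨB₁ a ν S - ΦB a S) (ΦB a S) ρB) →
      ∀ a > (0:ℝ), ∃ c > (0:ℝ), ∀ lo hi ΛV β : ℝ, 0 < lo → lo ≤ hi → 1 < ΛV → 0 ≤ β → hi * ΛV ≤ 11/10 → 10/11 * ΛV ≤ lo → β * ΛV ≤ lo / 20 →
        ∃ θV > (0:ℝ), ∃ σ > (0:ℝ), ∃ C : ℝ, 0 ≤ C ∧ ∃ ν₀ > (0:ℝ), ∃ K > (0:ℝ),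
          VmodDist.SlowVectorClauseFθg cubatureWord MB MB_pos c (ΨB₁ a) lo hi ΛV β σ C ν₀ K θV) :
    ∀ a > (0:ℝ), D1ExactFamilyRθg (ΦB a) ρB MB MB_pos :=
  D1ExactFamilyRBθg_of_split νB₁_pos hres (hV0θg hres)

end

end Summit.AnomalousDissipation.AnomalousDissipation.Theorems.SolenoidalFractalHomogenisation.LagrangianStep.WCrossing
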